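import Summits.ResolutionOfSingularities.ResolutionOfSingularities.Theorems.EquisingularLiftEquisingularLiftNatNormalSheafCoordinates
import Summits.ResolutionOfSingularities.ResolutionOfSingularities.Theorems.EquisingularLiftEquisingularLiftNatP1VBTwoChartCech
import Summits.ResolutionOfSingularities.ResolutionOfSingularities.Theorems.EquisingularLiftEquisingularLiftNatDirStepUnobsTransport
import HarnessLib

/-!
# [OURS · L1 W4.5(b) · EL♮(3) · nose residue, brick «NOSE UNOBSTRUCTEDNESS ENGINE»] The generic PRODUCER of `DirStepUnobs`:
# `Ȟ¹` of the normal sheaf vanishes on two compatible regular generator charts with a twisted splitting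

Cell `res-hironaka`, LADDER-RESOLUTION rung L (D-0089), slot W4.5(b), crux chain w45b: child crux **EL♮(3)** =
stmt-ResolutionOfSingularities-20148 (`Theses.EquisingularLift.EquisingularLiftNatThree`), parent EL♮ = stmt-…-20038; registered nose residue
of record `stub_elnat_three_nonisolated_nonUnobsNonPointsFirstNoseBTriplePrime` (38th registration, CHILD v44r). WIDTH seat res-L1-w45b-nose-w1 g2
(D-0157 DOOR 1, KEY `KEY-res-L1-w45b-width.md` b349b720da383098; default brick of a free nose hand, STATUS 2026-08-28T17:52Z).
`--supports stmt-ResolutionOfSingularities-20148 --as helper`. OURS; NOT a statement of H. Hironaka's 2017 manuscript (nothing of [Hironaka2017] is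
asserted anywhere in this file); AI-written, and AI review is weaker than expert review. DEF-FREE; no `sorry`; standard axioms. EL♮(3) is NOT proved by
this file; resolution of singularities in positive characteristic is NOT proved here (dimension 3 is Cossart–Piltant 2008/2009 in print).

WHY. The downstairs clause `DirStepUnobs G E hE Γ hΓ` (tree `…NatDirZeroDefs`: «for the closed immersion `i : Γ̃ ⟶ Ẽ` of reduced structures,
`Ȟ¹(V; 𝒩_{Γ̃/Ẽ}) = 0` on SOME affine two-cover `V` of `Γ̃` with affine overlap») is CONSUMED by the whole chain — B0 `dirStepUnobs_transport`, B3/D1,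
every `Tower*RoundOfFact`, the nose rungs (N4) `hsub_reachPtNoseBTriplePrime_of_fact` / (R-ν1) `…NatUnobsNoseFirstRung` (`hunobs : DirStepUnobs F₁ univ _ Z hZ`),
the (T-k)-at-`⊥` application — but before this file NO tree declaration CONCLUDED it: the ν1/ν2 nose predicates `NoseHypUnobsBTriplePrime` /
`NoseHypPointsFirstBTriplePrime` (…NatResidueHypDefs5, 36th/37th registrations) had no kernel inhabitant, and res-L1-w45b-nose-w3's Steiner certificate
(`STEINER-TEST.md` a7ce31f9a1b4b5ba, (P4)) names «`DirStepUnobs F₂ univ _ Z′` for the strict transforms of the three double lines» as the one genuinely new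
brick. This file is the generic engine such certificates instantiate at ring level.

RELATION TO p654480 (res-L1-w45b-nose-w3 g2, `…NatDirStepUnobsOfTwoCharts`, landed 2026-08-28T17:51Z while this file was being checked): that file is the
FIRST producer of `DirStepUnobs`, for AGREEING generators (`x 0 j| = x 1 j|`, transition matrix `1`, i.e. a conormal frame that extends over both charts —
`𝒩 ≅ 𝒪^n` on the union) with the plain splitting `Ȟ¹(𝒪_Z) = 0`. THIS file is the TWISTED generalisation — an arbitrary transition matrix `M` on the overlap
and the correspondingly twisted splitting `c = a| + ι♯(M)·b|` — which is what non-trivial normal bundles need (a line in `ℙ³`: `𝒩 = 𝒪(1)²`, `M = (x₁/x₀)·1`;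
the NEST conic `Γ_q ⊂ E_q ≅ ℙ²` of R39: `𝒩 = 𝒪(4)`, `M` a unit; desk booking D3-7, STATUS 2026-08-28T17:52:33Z), plus the CUSTOMER FORMS on the ambient `G`
itself (`E = univ`, ring-level data modulo `𝓘⟨Γ⟩`, the `G_red ≅ G` transport done inside). For `M = 1` the core below and nose-w3's
`subsingleton_cechMH1_normalSheaf_of_twoCharts` prove the same vanishing (up to the sign convention of the splitting); neither file imports the other.

WHAT (all over tree vocabulary; `η(m)` = `Modules.unitSectionLE ι (idealModule ι) _ m`, the class of an ideal-module section in the conormal sheaf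
`𝒞 = ι^*𝓘 = Deformation.conormalSheaf ι`; `𝒩 = HodgeTheory.normalSheaf ι = 𝓗om(𝒞, 𝒪_Z)`):
* bookkeeping: `idealModule_section_map_eq_sum` (ideal-module sections whose readings satisfy `x₀ = M·x₁` on the overlap satisfy `s₀| = M•s₁|`,
  injectivity of `𝓘 ↪ 𝒪`), `map_unitSectionLE` / `unitSectionLE_map_eq` / `unitSectionLE_sum_smul'` (`η` vs restriction and finite sums),
  ★ `conormal_unitSectionLE_eq_sum` — THE TRANSITION OF CONORMAL CLASSES: `η(s⁰_k)|_W = Σ_j ι♯(M_kj)·η(s¹_j)|_W`;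
* ★★ `subsingleton_cechMH1_normalSheaf_of_charts` — for a closed immersion `ι : Z ⟶ X` into a locally Noetherian scheme, two affine charts
  `U : Fin 2 → X.affineOpens`, QUASI-REGULAR generators `x i` of `ker(ι♯)(U i)` (`IsQuasiRegular`, the currency of `exists_conormalFrame_of_generators_of_isQuasiRegular`
  p589925), a transition matrix `M` on `U 0 ⊓ U 1` with `x 0 k| = Σ_j M k j · x 1 j|`, and the TWISTED SPLITTING «every tuple `c` of functions on
  `ι⁻¹U 0 ∩ ι⁻¹U 1` is `c_k = a_k| + Σ_j ι♯(M_kj)·b_j|` with `a` from `ι⁻¹U 0`, `b` from `ι⁻¹U 1`»: `Ȟ¹((ι⁻¹U 0, ι⁻¹U 1); 𝒩) = 0`.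
  PROOF (coordinates, no gluing): T-P1VB `P1VB.subsingleton_cechMH1_iff` reduces to splitting one section `μ` of `𝒩` over the overlap `W`; in the conormal
  frames `e i` (basis `η(sⁱ)`), restricted to `W` (`restrictTrivialisation`), `μ` has dual coordinates `c_k = μ(η(s⁰_k)|)` ((ν1) `dualCoord`, …NatNormalSheafCoordinates);
  split `c = a| + M̄·b|`; the sections `μ₀ := homOfBasisValues (e 0) (−a)`, `μ₁ := homOfBasisValues (e 1) b` satisfy `μ₁|_W − μ₀|_W = μ` because both sides have
  the same `e 0|_W`-coordinates — for `μ₁|_W` this is the transition `η(s⁰_k)| = Σ M̄_kj η(s¹_j)|` and linearity of `μ₁`; conclude by `dualCoord_injective`.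
* ★★ `dirStepUnobs_of_charts` — the same packaged as `DirStepUnobs G E hE Γ hΓ` for charts on the reduced surface `Ẽ` (the tested `i` equals the given
  `i₀` since `Ẽ ⟶ G` is a monomorphism; preimages of affine charts under the closed immersion are affine).
* ★★★ `dirStepUnobs_univ_of_charts` / `dirStepUnobs_univ_of_two_charts` — THE CUSTOMER FORM for the nose rungs (`E = univ`, `G` reduced and locally
  Noetherian): charts `U 0, U 1` are affine opens OF `G`, generators generate `𝓘⟨Γ⟩.ideal (U i)` (`𝓘⟨Γ⟩ = vanishingIdeal ⟨Γ, hΓ⟩`), `Γ ⊆ U 0 ∪ U 1`, `U 0 ⊓ U 1`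
  affine, and the splitting is RING-LEVEL ON `G`: `c_k − (a_k| + Σ_j M_kj·b_j|) ∈ 𝓘⟨Γ⟩.ideal (U 0 ⊓ U 1)`. Conclusion `DirStepUnobs G Set.univ isClosed_univ Γ hΓ`
  — literally the `hunobs` binder of (R-ν1) / (N4) / (T-k)-at-`⊥`. Inside: the core for `ι = 𝓘⟨Γ⟩.subschemeι : Γ̃ ⟶ G` (`ker_subschemeι`,
  `subschemeι_app_surjective`, `ker_subschemeι_app` move the ring-level data to `Γ̃`), then B0's transport kit (`nonempty_pushforward_normalSheaf_iso`,
  `subsingleton_cechMH1_of_schemeIso`) along `i ≫ ι_E = ι` with `ι_E : G̃ = G_red ⟶ G` an isomorphism (`isIso_subschemeι_iff_eq_bot`, `vanishingIdeal_top`,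
  `Scheme.nilradical_eq_bot`).
INSTANCES TO EXPECT (not in this file): a strict transform `L′ ⊂ Bl_P ℙ³` of a line through `P` (Steiner's `Z′`, 𝒩 = 𝒪 ⊕ 𝒪): `M = 1`, splitting
`k[t, t⁻¹] = k[t] + k[t⁻¹]`; a line `L ⊂ ℙ³` on `D₊(x), D₊(w)` (𝒩 = 𝒪(1)²): `M = (w/x)·1`, splitting `c = a + t·b`; disjoint unions chart by chart.

References (method / index only): R. Hartshorne, *Algebraic Geometry* (1977), II.5, II.8 Thm. 8.17, III.4–III.5 (Čech cohomology of `𝒪(n)` on the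
standard cover) [cite: Hartshorne1977]; The Stacks Project, Tags 01ED, 08KY [cite: StacksProject]; R.-O. Buchweitz, H. Flenner (2003) §1 (the normal sheaf)
[cite: BuchweitzFlenner2003].
-/

set_option linter.dupNamespace false -- mandated namespace `Summit.<Summit>.<Problem>` of this single-conjunct summit

noncomputable section

-- `TopCat.Presheaf`/`Scheme.Modules` are not reducible (as in Mathlib's `AlgebraicGeometry/Modules`).
set_option backward.isDefEq.respectTransparency false

open CategoryTheory CategoryTheory.Limits AlgebraicGeometry Opposite TopologicalSpace
open Literature.AlgebraicGeometry.Modules Literature.AlgebraicGeometry.Deformation Literature.AlgebraicGeometry.Motives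
open Literature.AlgebraicGeometry.HodgeTheory Literature.AlgebraicGeometry.Resolution
open Literature.AlgebraicGeometry.Morphisms

namespace Summit.ResolutionOfSingularities.ResolutionOfSingularities.Cruxes.EquisingularLiftNat.Sections

variable {X Z : Scheme.{0}} (ι : Z ⟶ X)

/-! ### Bookkeeping: ideal-module sections and their conormal classes under a transition matrix -/

/-- **Ideal-module sections follow their readings**: if `s⁰_j ↦ x₀ j`, `s¹_j ↦ x₁ j` and `x₀ k| = Σ_j M k j · x₁ j|` on `U₀ ∩ U₁`, then
`s⁰_k| = Σ_j M k j • s¹_j|` in `Γ(U₀ ∩ U₁, 𝓘)` (injectivity of `𝓘 ↪ 𝒪`). [cite: StacksProject, Tag 08KY] [folklore] -/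
theorem idealModule_section_map_eq_sum [IsClosedImmersion ι] {U₀ U₁ : X.Opens} {n : ℕ}
    (x₀ : Fin n → Γ(X, U₀)) (x₁ : Fin n → Γ(X, U₁))
    (s₀ : Fin n → Γ(idealModule ι, U₀)) (s₁ : Fin n → Γ(idealModule ι, U₁))
    (hs₀ : ∀ j, toRing (idealModuleι ι) U₀ (s₀ j) = x₀ j) (hs₁ : ∀ j, toRing (idealModuleι ι) U₁ (s₁ j) = x₁ j)
    (M : Fin n → Fin n → Γ(X, U₀ ⊓ U₁))
    (hM : ∀ k, X.presheaf.map (homOfLE inf_le_left).op (x₀ k) =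
      ∑ j, M k j * X.presheaf.map (homOfLE inf_le_right).op (x₁ j)) (k : Fin n) :
    (idealModule ι).presheaf.map (homOfLE (inf_le_left : U₀ ⊓ U₁ ≤ U₀)).op (s₀ k) =
      ∑ j, M k j • (idealModule ι).presheaf.map (homOfLE (inf_le_right : U₀ ⊓ U₁ ≤ U₁)).op (s₁ j) := by
  apply kernel_ι_app_injective (structureModuleMap ι) (U₀ ⊓ U₁)
  change toRing (idealModuleι ι) (U₀ ⊓ U₁) _ = toRing (idealModuleι ι) (U₀ ⊓ U₁) _
  rw [← map_toRing, hs₀, hM]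
  have hsum : toRing (idealModuleι ι) (U₀ ⊓ U₁)
      (∑ j, M k j • (idealModule ι).presheaf.map (homOfLE (inf_le_right : U₀ ⊓ U₁ ≤ U₁)).op (s₁ j)) =
      ∑ j, toRing (idealModuleι ι) (U₀ ⊓ U₁)
        (M k j • (idealModule ι).presheaf.map (homOfLE (inf_le_right : U₀ ⊓ U₁ ≤ U₁)).op (s₁ j)) :=
    map_sum ((idealModuleι ι).app (U₀ ⊓ U₁)).hom _ _
  rw [hsum]
  refine Finset.sum_congr rfl fun j _ => ?_
  rw [toRing_smul, ← map_toRing, hs₁]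

/-- **`η` and restriction of the target open**: `η(m)|_{U'} = η(m)` read over `U' ≤ U`. [cite: Hartshorne1977, II.5 (p. 110)] [folklore] -/
theorem map_unitSectionLE {V : X.Opens} {U U' : Z.Opens} (h : U ≤ ι ⁻¹ᵁ V) (k : U' ⟶ U) (m : Γ(idealModule ι, V)) :
    (conormalSheaf ι).presheaf.map k.op (unitSectionLE ι (idealModule ι) h m) =
      unitSectionLE ι (idealModule ι) (k.le.trans h) m := by
  rw [unitSectionLE, unitSectionLE]
  change ((Scheme.Modules.pullback ι).obj (idealModule ι)).presheaf.map k.op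
    (((Scheme.Modules.pullback ι).obj (idealModule ι)).presheaf.map (homOfLE h).op (unitSection ι (idealModule ι) V m)) = _
  rw [presheaf_map_map]
  rfl

/-- **`η` of a restricted ideal section** is `η` of the section (the source open only bounds the target open). [cite: Hartshorne1977, II.5 (p. 110)] [folklore] -/
theorem unitSectionLE_map_eq {V V' : X.Opens} (k : V' ≤ V) {U : Z.Opens} (h : U ≤ ι ⁻¹ᵁ V') (m : Γ(idealModule ι, V)) :
    unitSectionLE ι (idealModule ι) h ((idealModule ι).presheaf.map (homOfLE k).op m) =
      unitSectionLE ι (idealModule ι) (h.trans (ι.preimage_mono k)) m := by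
  rw [unitSectionLE, unitSectionLE, unitSection_map, presheaf_map_map]
  rfl

/-- **`η` is `ι♯`-semilinear on finite sums**, for any target open `U ≤ ι⁻¹V`: `η(Σ a_j m_j) = Σ ι♯(a_j)|_U · η(m_j)` (the `le_refl` spelling is
`unitSectionLE_sum_smul` of …NatConormalChartDictionary). [cite: Hartshorne1977, II.5 (p. 110)] [folklore] -/
theorem unitSectionLE_sum_smul' {V : X.Opens} {U : Z.Opens} (h : U ≤ ι ⁻¹ᵁ V) {n : ℕ} (a : Fin n → Γ(X, V))
    (m : Fin n → Γ(idealModule ι, V)) :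
    unitSectionLE ι (idealModule ι) h (∑ j, a j • m j) = ∑ j, ι.appLE V U h (a j) • unitSectionLE ι (idealModule ι) h (m j) := by
  classical
  let η : Γ(idealModule ι, V) →+ Γ(conormalSheaf ι, U) :=
    { toFun := unitSectionLE ι (idealModule ι) h
      map_zero' := by
        have h0 := unitSectionLE_add ι (idealModule ι) h (0 : Γ(idealModule ι, V)) 0
        rw [add_zero] at h0
        exact left_eq_add.mp h0
      map_add' := unitSectionLE_add ι (idealModule ι) h }
  change η (∑ j, a j • m j) = _
  rw [map_sum]
  exact Finset.sum_congr rfl fun j _ => unitSectionLE_smul ι (idealModule ι) h (a j) (m j)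

/-- ★ **The transition of conormal classes.** For ideal sections `s⁰ ↦ x₀` over `U₀`, `s¹ ↦ x₁` over `U₁` with `x₀ k| = Σ_j M k j · x₁ j|` on `U₀ ∩ U₁`,
and any open `W ≤ ι⁻¹(U₀ ∩ U₁)` of `Z`: `η(s⁰_k)|_W = Σ_j ι♯(M k j)|_W • η(s¹_j)|_W` in `Γ(W, ι^*𝓘)`. [cite: Hartshorne1977, II.8 Thm. 8.17] [folklore] -/
theorem conormal_unitSectionLE_eq_sum [IsClosedImmersion ι] {U₀ U₁ : X.Opens} {n : ℕ}
    (x₀ : Fin n → Γ(X, U₀)) (x₁ : Fin n → Γ(X, U₁))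
    (s₀ : Fin n → Γ(idealModule ι, U₀)) (s₁ : Fin n → Γ(idealModule ι, U₁))
    (hs₀ : ∀ j, toRing (idealModuleι ι) U₀ (s₀ j) = x₀ j) (hs₁ : ∀ j, toRing (idealModuleι ι) U₁ (s₁ j) = x₁ j)
    (M : Fin n → Fin n → Γ(X, U₀ ⊓ U₁))
    (hM : ∀ k, X.presheaf.map (homOfLE inf_le_left).op (x₀ k) =
      ∑ j, M k j * X.presheaf.map (homOfLE inf_le_right).op (x₁ j))
    {W : Z.Opens} (hW : W ≤ ι ⁻¹ᵁ (U₀ ⊓ U₁)) (k : Fin n) :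
    unitSectionLE ι (idealModule ι) (hW.trans (ι.preimage_mono inf_le_left)) (s₀ k) =
      ∑ j, ι.appLE (U₀ ⊓ U₁) W hW (M k j) •
        unitSectionLE ι (idealModule ι) (hW.trans (ι.preimage_mono inf_le_right)) (s₁ j) := by
  rw [← unitSectionLE_map_eq ι inf_le_left hW, idealModule_section_map_eq_sum ι x₀ x₁ s₀ s₁ hs₀ hs₁ M hM k,
    unitSectionLE_sum_smul']
  refine Finset.sum_congr rfl fun j _ => ?_
  rw [unitSectionLE_map_eq]

/-! ### The core: `Ȟ¹` of the normal sheaf on two compatible charts -/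

/-- The overlap of the two preimage charts lies over the overlap of the charts (definitional). [folklore] -/
theorem preimage_inf_le_preimage_inf (U₀ U₁ : X.Opens) : ι ⁻¹ᵁ U₀ ⊓ ι ⁻¹ᵁ U₁ ≤ ι ⁻¹ᵁ (U₀ ⊓ U₁) := fun _ hx => hx

/-- ★★ **`Ȟ¹` of the normal sheaf vanishes on two compatible quasi-regular generator charts with a twisted splitting.** `ι : Z ⟶ X` a closed immersion,
`X` locally Noetherian, `U : Fin 2 → X.affineOpens`, `x i` quasi-regular generators of `ker(ι♯)(U i)`, `M` the transition on `U 0 ∩ U 1`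
(`x 0 k| = Σ_j M k j · x 1 j|`), and every tuple of functions on `ι⁻¹U 0 ∩ ι⁻¹U 1` splits as `c_k = a_k| + Σ_j ι♯(M k j)·b_j|` ⟹
`Ȟ¹((ι⁻¹U 0, ι⁻¹U 1); 𝒩_{Z/X}) = 0` (tree `Morphisms.CechMH1` of `HodgeTheory.normalSheaf ι`). Proof in the module docstring (conormal frames p589925,
(ν1) dual coordinates, `conormal_unitSectionLE_eq_sum`, `P1VB.subsingleton_cechMH1_iff`). [cite: Hartshorne1977, III.5 (Čech computation on two charts)]
[OURS · L1 W4.5b · EL♮(3) · nose residue «unobstructedness engine»; NOT a statement of the manuscript] -/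
theorem subsingleton_cechMH1_normalSheaf_of_charts [IsClosedImmersion ι] [IsLocallyNoetherian X]
    (U : Fin 2 → X.affineOpens) {n : ℕ} (x : (i : Fin 2) → Fin n → Γ(X, (U i : X.Opens)))
    (hqr : ∀ i, IsQuasiRegular (x i)) (hI : ∀ i, Ideal.span (Set.range (x i)) = ι.ker.ideal (U i))
    (M : Fin n → Fin n → Γ(X, (U 0 : X.Opens) ⊓ U 1))
    (hM : ∀ k, X.presheaf.map (homOfLE inf_le_left).op (x 0 k) =
      ∑ j, M k j * X.presheaf.map (homOfLE inf_le_right).op (x 1 j))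
    (hsplit : ∀ c : Fin n → Γ(Z, ι ⁻¹ᵁ (U 0 : X.Opens) ⊓ ι ⁻¹ᵁ (U 1 : X.Opens)),
      ∃ v : (i : Fin 2) → Fin n → Γ(Z, ι ⁻¹ᵁ (U i : X.Opens)), ∀ k,
        c k = Z.presheaf.map (homOfLE inf_le_left).op (v 0 k) +
          ∑ j, ι.appLE ((U 0 : X.Opens) ⊓ U 1) _ (preimage_inf_le_preimage_inf ι (U 0) (U 1)) (M k j) *
            Z.presheaf.map (homOfLE inf_le_right).op (v 1 j)) :
    Subsingleton (CechMH1 Z.toSpecΓ (normalSheaf ι) (fun i : Fin 2 => ι ⁻¹ᵁ (U i : X.Opens))) := by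
  choose s e hs he using fun i => exists_conormalFrame_of_generators_of_isQuasiRegular ι (U i) (x i) (hqr i) (hI i)
  rw [P1VB.subsingleton_cechMH1_iff]
  intro y
  -- the overlap and the restricted frames
  let W : Z.Opens := ι ⁻¹ᵁ (U 0 : X.Opens) ⊓ ι ⁻¹ᵁ (U 1 : X.Opens)
  have hW : W ≤ ι ⁻¹ᵁ ((U 0 : X.Opens) ⊓ U 1) := preimage_inf_le_preimage_inf ι (U 0) (U 1)
  let k₀ : W ⟶ ι ⁻¹ᵁ (U 0 : X.Opens) := homOfLE inf_le_left
  let k₁ : W ⟶ ι ⁻¹ᵁ (U 1 : X.Opens) := homOfLE inf_le_right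
  let e₀ := SheafOfModules.restrictTrivialisation (R := Z.ringCatSheaf) k₀ (e 0)
  let e₁ := SheafOfModules.restrictTrivialisation (R := Z.ringCatSheaf) k₁ (e 1)
  -- the section `y` as a morphism out of the framed conormal sheaf over `W`
  let μ : (conormalSheaf ι).over W ⟶ (unitModule Z).over W := y
  obtain ⟨v, hv⟩ := hsplit (fun k => dualCoord e₀ μ k)
  -- the two local sections: values `-v 0` on the chart `0`, `v 1` on the chart `1`
  let w : (i : Fin 2) → Fin n → Γ(Z, ι ⁻¹ᵁ (U i : X.Opens)) := fun i k => if i = 0 then -(v i k) else v i k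
  have hw0 : ∀ k, w 0 k = -(v 0 k) := fun k => by simp [w]
  have hw1 : ∀ k, w 1 k = v 1 k := fun k => by simp [w]
  refine ⟨fun i => homOfBasisValues (e i) (M := unitModule Z) (w i), ?_⟩
  rw [P1VB.cechDelta_apply, MSections.res_apply, MSections.res_apply]
  change restrictHom k₁ (homOfBasisValues (e 1) (M := unitModule Z) (w 1)) -
      restrictHom k₀ (homOfBasisValues (e 0) (M := unitModule Z) (w 0)) = μ
  apply dualCoord_injective e₀
  funext k
  change dualCoord e₀ (restrictHom k₁ (homOfBasisValues (e 1) (M := unitModule Z) (w 1)) -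
      restrictHom k₀ (homOfBasisValues (e 0) (M := unitModule Z) (w 0))) k = dualCoord e₀ μ k
  rw [dualCoord_sub, hv k]
  -- chart `0`: restricted coordinates
  have hA : dualCoord e₀ (restrictHom k₀ (homOfBasisValues (e 0) (M := unitModule Z) (w 0))) k =
      -(Z.presheaf.map (homOfLE inf_le_left).op (v 0 k)) := by
    change dualCoord (SheafOfModules.restrictTrivialisation (R := Z.ringCatSheaf) k₀ (e 0)) _ k = _
    rw [dualCoord_restrictTrivialisation, dualCoord_homOfBasisValues, hw0, map_neg]
  -- the basis of chart `0` over `W` in terms of the basis of chart `1`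
  have hbasis : basisSection e₀ k = ∑ j, ι.appLE ((U 0 : X.Opens) ⊓ U 1) W hW (M k j) • basisSection e₁ j := by
    change basisSection (SheafOfModules.restrictTrivialisation (R := Z.ringCatSheaf) k₀ (e 0)) k =
      ∑ j, _ • basisSection (SheafOfModules.restrictTrivialisation (R := Z.ringCatSheaf) k₁ (e 1)) j
    rw [basisSection_restrictTrivialisation, he 0 k, map_unitSectionLE,
      conormal_unitSectionLE_eq_sum ι (x 0) (x 1) (s 0) (s 1) (hs 0) (hs 1) M hM hW k]
    refine Finset.sum_congr rfl fun j _ => ?_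
    rw [basisSection_restrictTrivialisation, he 1 j, map_unitSectionLE]
  -- chart `1`: coordinates in the transported basis
  have hB : dualCoord e₀ (restrictHom k₁ (homOfBasisValues (e 1) (M := unitModule Z) (w 1))) k =
      ∑ j, ι.appLE ((U 0 : X.Opens) ⊓ U 1) W hW (M k j) * Z.presheaf.map (homOfLE inf_le_right).op (v 1 j) := by
    rw [dualCoord_def, hbasis, appLE_sum_right Finset.univ]
    refine Finset.sum_congr rfl fun j _ => ?_
    rw [appLE_smul_right, ← dualCoord_def]
    change _ • dualCoord (SheafOfModules.restrictTrivialisation (R := Z.ringCatSheaf) k₁ (e 1)) _ j = _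
    rw [dualCoord_restrictTrivialisation, dualCoord_homOfBasisValues, hw1]
    rfl
  rw [hA, hB, sub_neg_eq_add, add_comm]

/-! ### `DirStepUnobs` packaging -/

/-- ★★★ **The customer form (`E = univ`, reduced ambient): `DirStepUnobs G univ _ Γ` from two compatible quasi-regular generator charts of `𝓘⟨Γ⟩` ON `G`
and a RING-LEVEL twisted splitting modulo `𝓘⟨Γ⟩` on the overlap.** Hypotheses: `G` locally Noetherian and reduced; `U 0`, `U 1` affine opens of `G` with
affine intersection covering the closed set `Γ`; `x i` quasi-regular generators of `𝓘⟨Γ⟩.ideal (U i)`; `M` with `x 0 k| = Σ_j M k j · x 1 j|`; every tuple `c`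
on `U 0 ∩ U 1` satisfies `c_k − (a_k| + Σ_j M k j · b_j|) ∈ 𝓘⟨Γ⟩.ideal (U 0 ∩ U 1)` for some tuples `a` on `U 0`, `b` on `U 1`. Conclusion: the `hunobs` binder
`DirStepUnobs G Set.univ isClosed_univ Γ hΓ` of (R-ν1) `…NatUnobsNoseFirstRung` / (N4) / (T-k)-at-`⊥`. [cite: Hartshorne1977, III.5]
[OURS · L1 W4.5b · EL♮(3) · nose residue «unobstructedness engine»; NOT a statement of the manuscript] -/
theorem dirStepUnobs_univ_of_charts (G : Scheme.{0}) [IsLocallyNoetherian G] [IsReduced G]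
    (Γ₀ : Set G) (hΓ : IsClosed Γ₀)
    (U : Fin 2 → G.affineOpens) (h01 : IsAffineOpen ((U 0 : G.Opens) ⊓ U 1))
    (hcov : Γ₀ ⊆ ((U 0 : G.Opens) : Set G) ∪ ((U 1 : G.Opens) : Set G))
    {n : ℕ} (x : (i : Fin 2) → Fin n → Γ(G, (U i : G.Opens))) (hqr : ∀ i, IsQuasiRegular (x i))
    (hI : ∀ i, Ideal.span (Set.range (x i)) =
      (Scheme.IdealSheafData.vanishingIdeal (⟨Γ₀, hΓ⟩ : Closeds G)).ideal (U i))
    (M : Fin n → Fin n → Γ(G, (U 0 : G.Opens) ⊓ U 1))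
    (hM : ∀ k, G.presheaf.map (homOfLE inf_le_left).op (x 0 k) =
      ∑ j, M k j * G.presheaf.map (homOfLE inf_le_right).op (x 1 j))
    (hsplit : ∀ c : Fin n → Γ(G, (U 0 : G.Opens) ⊓ U 1), ∃ v : (i : Fin 2) → Fin n → Γ(G, (U i : G.Opens)), ∀ k,
      c k - (G.presheaf.map (homOfLE inf_le_left).op (v 0 k) +
          ∑ j, M k j * G.presheaf.map (homOfLE inf_le_right).op (v 1 j)) ∈
        (Scheme.IdealSheafData.vanishingIdeal (⟨Γ₀, hΓ⟩ : Closeds G)).ideal ⟨(U 0 : G.Opens) ⊓ U 1, h01⟩) :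
    DirStepUnobs G Set.univ isClosed_univ Γ₀ hΓ := by
  intro i hi
  set I : G.IdealSheafData := Scheme.IdealSheafData.vanishingIdeal (⟨Γ₀, hΓ⟩ : Closeds G) with hIdef
  -- the closed immersion `ι : Γ̃ ⟶ G` and the isomorphism `G̃ = G_red ≅ G`
  let ι : redSub G Γ₀ hΓ ⟶ G := redSubι G Γ₀ hΓ
  haveI hEiso : IsIso (redSubι G Set.univ isClosed_univ) :=
    (Scheme.isIso_subschemeι_iff_eq_bot _).mpr (by
      rw [show (⟨Set.univ, isClosed_univ⟩ : Closeds G) = ⊤ from rfl, Scheme.IdealSheafData.vanishingIdeal_top,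
        Scheme.nilradical_eq_bot])
  -- STEP 1: the core on `(G ⊇ Γ̃)`
  have hker : ∀ j, Ideal.span (Set.range (x j)) = ι.ker.ideal (U j) := fun j => by
    rw [hI j]
    change _ = (Scheme.IdealSheafData.subschemeι I).ker.ideal (U j)
    rw [Scheme.IdealSheafData.ker_subschemeι]
  have hsplitZ : ∀ c : Fin n → Γ(redSub G Γ₀ hΓ, ι ⁻¹ᵁ (U 0 : G.Opens) ⊓ ι ⁻¹ᵁ (U 1 : G.Opens)),
      ∃ v : (j : Fin 2) → Fin n → Γ(redSub G Γ₀ hΓ, ι ⁻¹ᵁ (U j : G.Opens)), ∀ k,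
        c k = (redSub G Γ₀ hΓ).presheaf.map (homOfLE inf_le_left).op (v 0 k) +
          ∑ j, ι.appLE ((U 0 : G.Opens) ⊓ U 1) _ (preimage_inf_le_preimage_inf ι (U 0) (U 1)) (M k j) *
            (redSub G Γ₀ hΓ).presheaf.map (homOfLE inf_le_right).op (v 1 j) := by
    intro c
    have hsurj : Function.Surjective (ι.app ((U 0 : G.Opens) ⊓ U 1)) :=
      I.subschemeι_app_surjective ⟨(U 0 : G.Opens) ⊓ U 1, h01⟩
    choose c' hc' using fun k => hsurj (c k)
    obtain ⟨v, hv⟩ := hsplit c'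
    refine ⟨fun j k => ι.app (U j : G.Opens) (v j k), fun k => ?_⟩
    have hkerU : RingHom.ker (ι.app ((U 0 : G.Opens) ⊓ U 1)).hom = I.ideal ⟨(U 0 : G.Opens) ⊓ U 1, h01⟩ :=
      I.ker_subschemeι_app ⟨(U 0 : G.Opens) ⊓ U 1, h01⟩
    have hzero : ι.app ((U 0 : G.Opens) ⊓ U 1) (c' k - (G.presheaf.map (homOfLE inf_le_left).op (v 0 k) +
          ∑ j, M k j * G.presheaf.map (homOfLE inf_le_right).op (v 1 j))) = 0 := by
      rw [← RingHom.mem_ker]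
      change _ ∈ RingHom.ker (ι.app ((U 0 : G.Opens) ⊓ U 1)).hom
      rw [hkerU]
      exact hv k
    rw [map_sub, sub_eq_zero, hc', map_add, map_sum] at hzero
    -- naturality of `ι♯` with restriction
    have hnat : ∀ (j : Fin 2) (hj : (U 0 : G.Opens) ⊓ U 1 ≤ U j) (hj' : ι ⁻¹ᵁ (U 0 : G.Opens) ⊓ ι ⁻¹ᵁ (U 1 : G.Opens) ≤ ι ⁻¹ᵁ (U j : G.Opens))
        (a : Γ(G, (U j : G.Opens))),
        ι.app ((U 0 : G.Opens) ⊓ U 1) (G.presheaf.map (homOfLE hj).op a) =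
          (redSub G Γ₀ hΓ).presheaf.map (homOfLE hj').op (ι.app (U j : G.Opens) a) := by
      intro j hj hj' a
      rw [← CommRingCat.comp_apply, ← CommRingCat.comp_apply, Scheme.Hom.app_eq_appLE, Scheme.Hom.map_appLE,
        Scheme.Hom.app_eq_appLE, Scheme.Hom.appLE_map]
      rfl
    rw [hzero]
    congr 1
    · exact hnat 0 inf_le_left inf_le_left (v 0 k)
    · refine Finset.sum_congr rfl fun j _ => ?_
      rw [map_mul, hnat 1 inf_le_right inf_le_right (v 1 j), Scheme.Hom.app_eq_appLE]
      rfl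
  have hcore := subsingleton_cechMH1_normalSheaf_of_charts ι U x hqr hker M hM hsplitZ
  -- STEP 2: the two charts cover `Γ̃` (`range ι = Γ ⊆ U 0 ∪ U 1`)
  have hVtop : ⨆ j, ι ⁻¹ᵁ (U j : G.Opens) = ⊤ := by
    rw [eq_top_iff]
    rintro z -
    have hz : (ι z : G) ∈ ((⟨Γ₀, hΓ⟩ : Closeds G) : Set G) := by
      rw [← Scheme.IdealSheafData.coe_support_vanishingIdeal, ← Scheme.IdealSheafData.range_subschemeι]
      exact ⟨z, rfl⟩
    rcases hcov hz with h | h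
    · exact Opens.mem_iSup.mpr ⟨0, h⟩
    · exact Opens.mem_iSup.mpr ⟨1, h⟩
  -- STEP 3: transport `Ȟ¹(𝒩_ι) = 0` to `Ȟ¹(𝒩_i) = 0` along `i ≫ ι_E = ι` with `ι_E : G̃ ⟶ G` an isomorphism (B0's kit)
  let β : G ≅ redSub G Set.univ isClosed_univ := (asIso (redSubι G Set.univ isClosed_univ)).symm
  have hsq : ι ≫ β.hom = (Iso.refl (redSub G Γ₀ hΓ)).hom ≫ i := by
    rw [Iso.refl_hom, Category.id_comp, Iso.symm_hom, asIso_inv, IsIso.comp_inv_eq, hi]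
  obtain ⟨e𝒩⟩ := nonempty_pushforward_normalSheaf_iso (i := ι) (i₁ := i) (α := Iso.refl _) (β := β) hsq
  have hfin := subsingleton_cechMH1_of_schemeIso (redSub G Γ₀ hΓ).toSpecΓ (normalSheaf ι)
    (fun j : Fin 2 => ι ⁻¹ᵁ (U j : G.Opens)) (Iso.refl _) (redSub G Γ₀ hΓ).toSpecΓ (by simp) e𝒩 hcore
  exact ⟨preimageFamily (Iso.refl (redSub G Γ₀ hΓ)).inv (fun j : Fin 2 => ι ⁻¹ᵁ (U j : G.Opens)),
    fun j => ((U j).2.preimage ι).preimage_of_isIso _, ((h01.preimage ι).preimage_of_isIso (Iso.refl _).inv : _),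
    Scheme.Hom.iSup_preimage_eq_top _ hVtop, hfin⟩

/-- ★★ **General `E`: `DirStepUnobs G E _ Γ` from two compatible quasi-regular generator charts of the ideal of `Γ̃` inside the reduced `Ẽ`** (charts are
affine opens of `Ẽ`, the generators generate `ker(i₀♯)`, the splitting is at the level of functions on `Γ̃`; the tested immersion `i` equals the given `i₀` because
`Ẽ ⟶ G` is a monomorphism). [cite: Hartshorne1977, III.5] [OURS · L1 W4.5b · EL♮(3) · nose residue «unobstructedness engine»; NOT a statement of the manuscript] -/
theorem dirStepUnobs_of_charts (G : Scheme.{0}) [IsLocallyNoetherian G] (E : Set G) (hE : IsClosed E) (Γ₀ : Set G) (hΓ : IsClosed Γ₀)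
    (i₀ : redSub G Γ₀ hΓ ⟶ redSub G E hE) (hi₀ : i₀ ≫ redSubι G E hE = redSubι G Γ₀ hΓ)
    (U : Fin 2 → (redSub G E hE).affineOpens) (h01 : IsAffineOpen ((U 0 : (redSub G E hE).Opens) ⊓ U 1))
    (hcov : ⨆ j, i₀ ⁻¹ᵁ (U j : (redSub G E hE).Opens) = ⊤)
    {n : ℕ} (x : (j : Fin 2) → Fin n → Γ(redSub G E hE, (U j : (redSub G E hE).Opens))) (hqr : ∀ j, IsQuasiRegular (x j))
    (hI : ∀ j, Ideal.span (Set.range (x j)) = i₀.ker.ideal (U j))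
    (M : Fin n → Fin n → Γ(redSub G E hE, (U 0 : (redSub G E hE).Opens) ⊓ U 1))
    (hM : ∀ k, (redSub G E hE).presheaf.map (homOfLE inf_le_left).op (x 0 k) =
      ∑ j, M k j * (redSub G E hE).presheaf.map (homOfLE inf_le_right).op (x 1 j))
    (hsplit : ∀ c : Fin n → Γ(redSub G Γ₀ hΓ, i₀ ⁻¹ᵁ (U 0 : (redSub G E hE).Opens) ⊓ i₀ ⁻¹ᵁ (U 1 : (redSub G E hE).Opens)),
      ∃ v : (j : Fin 2) → Fin n → Γ(redSub G Γ₀ hΓ, i₀ ⁻¹ᵁ (U j : (redSub G E hE).Opens)), ∀ k,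
        c k = (redSub G Γ₀ hΓ).presheaf.map (homOfLE inf_le_left).op (v 0 k) +
          ∑ j, i₀.appLE ((U 0 : (redSub G E hE).Opens) ⊓ U 1) _ (preimage_inf_le_preimage_inf i₀ (U 0) (U 1)) (M k j) *
            (redSub G Γ₀ hΓ).presheaf.map (homOfLE inf_le_right).op (v 1 j)) :
    DirStepUnobs G E hE Γ₀ hΓ := by
  intro i hi
  have hii₀ : i = i₀ := by rw [← cancel_mono (redSubι G E hE), hi, hi₀]
  subst hii₀
  haveI : IsClosedImmersion (i ≫ redSubι G E hE) := hi ▸ inferInstance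
  haveI : IsClosedImmersion i := IsClosedImmersion.of_comp_isClosedImmersion i (redSubι G E hE)
  haveI : IsLocallyNoetherian (redSub G E hE) := LocallyOfFiniteType.isLocallyNoetherian (redSubι G E hE)
  exact ⟨fun j => i ⁻¹ᵁ (U j : (redSub G E hE).Opens), fun j => (U j).2.preimage i, (h01.preimage i : _), hcov,
    subsingleton_cechMH1_normalSheaf_of_charts i U x hqr hI M hM hsplit⟩

/-- ★★★ **Two-chart spelling of `dirStepUnobs_univ_of_charts`** (separate binders `U₀, U₁, x₀, x₁, a, b`; no `Fin 2`-indexed data — the form a specimen file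
instantiates from polynomial identities on two affine charts). [cite: Hartshorne1977, III.5]
[OURS · L1 W4.5b · EL♮(3) · nose residue «unobstructedness engine»; NOT a statement of the manuscript] -/
theorem dirStepUnobs_univ_of_two_charts (G : Scheme.{0}) [IsLocallyNoetherian G] [IsReduced G]
    (Γ₀ : Set G) (hΓ : IsClosed Γ₀) (U₀ U₁ : G.affineOpens) (h01 : IsAffineOpen ((U₀ : G.Opens) ⊓ U₁))
    (hcov : Γ₀ ⊆ ((U₀ : G.Opens) : Set G) ∪ ((U₁ : G.Opens) : Set G))
    {n : ℕ} (x₀ : Fin n → Γ(G, (U₀ : G.Opens))) (x₁ : Fin n → Γ(G, (U₁ : G.Opens)))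
    (hqr₀ : IsQuasiRegular x₀) (hqr₁ : IsQuasiRegular x₁)
    (hI₀ : Ideal.span (Set.range x₀) = (Scheme.IdealSheafData.vanishingIdeal (⟨Γ₀, hΓ⟩ : Closeds G)).ideal U₀)
    (hI₁ : Ideal.span (Set.range x₁) = (Scheme.IdealSheafData.vanishingIdeal (⟨Γ₀, hΓ⟩ : Closeds G)).ideal U₁)
    (M : Fin n → Fin n → Γ(G, (U₀ : G.Opens) ⊓ U₁))
    (hM : ∀ k, G.presheaf.map (homOfLE inf_le_left).op (x₀ k) =
      ∑ j, M k j * G.presheaf.map (homOfLE inf_le_right).op (x₁ j))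
    (hsplit : ∀ c : Fin n → Γ(G, (U₀ : G.Opens) ⊓ U₁), ∃ (a : Fin n → Γ(G, (U₀ : G.Opens))) (b : Fin n → Γ(G, (U₁ : G.Opens))),
      ∀ k, c k - (G.presheaf.map (homOfLE inf_le_left).op (a k) + ∑ j, M k j * G.presheaf.map (homOfLE inf_le_right).op (b j)) ∈
        (Scheme.IdealSheafData.vanishingIdeal (⟨Γ₀, hΓ⟩ : Closeds G)).ideal ⟨(U₀ : G.Opens) ⊓ U₁, h01⟩) :
    DirStepUnobs G Set.univ isClosed_univ Γ₀ hΓ := by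
  refine dirStepUnobs_univ_of_charts G Γ₀ hΓ ![U₀, U₁] h01 hcov
    (Fin.cons x₀ (Fin.cons x₁ fun j => j.elim0)) (Fin.forall_fin_two.mpr ⟨hqr₀, hqr₁⟩)
    (Fin.forall_fin_two.mpr ⟨hI₀, hI₁⟩) M hM fun c => ?_
  obtain ⟨a, b, h⟩ := hsplit c
  exact ⟨Fin.cons a (Fin.cons b fun j => j.elim0), h⟩

end Summit.ResolutionOfSingularities.ResolutionOfSingularities.Cruxes.EquisingularLiftNat.Sections

end
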